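import Mathlib
import HarnessLib

/-!
# Route `KLProgramme` — ENGINE child `KLRegimeEngineV11` (stmt-HubbardSuperconductivity-19823), two-leg stubs: DERIVATIVE BOUNDS TO
# ORDER FOUR FOR A SCALAR IMPLICIT FUNCTION `u′ = −G_θ(θ,u)/G_t(θ,u)` (generic calculus; cell gate-hubbard-kl, seat p1b g5)

The Fermi-point map of a frame `K`, `θ ↦ k_F^K(θ) = u_K(θ)·dir θ`, has polar radius `u_K` solving `G(θ, u_K(θ)) = μ` for the level
function `G(θ,t) = ε₀(t·dir θ) − K(t·dir θ)`; the p4 lineage proved `u_K ∈ C^∞` and the closed forms / bounds of `u′`, `u″` (BGM 2006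
Lemma 2.1 (2.40)–(2.41)).  The two-leg slot's (E3g) `TwoLegAngularG` needs orders `≤ 4` QUANTITATIVELY (`twoLegAngularG_of_curve_bounds`,
`…SplitTwoLegReductions`).  This file is the generic bootstrap: if `u ∈ C⁴` satisfies `u′(θ) = −G_θ(θ,u θ)/G_t(θ,u θ)` with `G_θ, G_t ∈ C³`,
`‖Dⁱ G_θ‖, ‖Dⁱ G_t‖ ≤ B` (`i ≤ 3`, `B ≥ 1`) at the graph points and `G_t ≥ d` there (`0 < d ≤ 1`), then

  `|u^{(j)}(θ)| ≤ (31104·B⁴/d⁴)^j`, `1 ≤ j ≤ 4` (`abs_iteratedDeriv_le_pow_of_implicit`).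

Mechanism: `u′ = −(G_θ ∘ g)·(G_t ∘ g)⁻¹` with `g = (id, u)`; Leibniz (`norm_iteratedFDeriv_mul_le`), the chain rule with factorial
constants (`norm_iteratedFDeriv_comp_le`, `…_comp_le'` for `x ↦ x⁻¹` on `(d/2, ∞)`), and induction on the order with one constant `D`
chosen so that each step closes (`72B²/d⁴, 1296B³/d⁴, 31104B⁴/d⁴ ≤ D`).  Proofs only.
-/

noncomputable section

namespace Summit.HubbardSuperconductivity.HubbardSuperconductivity.Theorems.PerturbedFermiCurve

set_option linter.dupNamespace false -- summit = problem name (single-conjunct summit), D-0017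

open Real Set Finset

/-! ## §1 One-dimensional bookkeeping -/

/-- The iterated derivatives of the identity of `ℝ` have norm `≤ 1` (order `1`: the identity map; higher orders: `0`). -/
theorem norm_iteratedFDeriv_id_le (i : ℕ) (hi : 1 ≤ i) (θ : ℝ) : ‖iteratedFDeriv ℝ i (fun x : ℝ => x) θ‖ ≤ 1 := by
  rw [norm_iteratedFDeriv_eq_norm_iteratedDeriv]
  obtain ⟨j, rfl⟩ : ∃ j, i = j + 1 := ⟨i - 1, by omega⟩
  rw [iteratedDeriv_succ', deriv_id'']
  rcases Nat.eq_zero_or_pos j with rfl | hj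
  · simp
  · rw [iteratedDeriv_const]
    simp [hj.ne']

/-- **The graph map `g = (id, u)` inherits the derivative bounds of `u`**: if `|u^{(i)}| ≤ Dⁱ` for `1 ≤ i ≤ k` (`D ≥ 1`), then
`‖Dⁱ g(θ)‖ ≤ Dⁱ` for `1 ≤ i ≤ k` (sup norm on `ℝ × ℝ`). -/
theorem norm_iteratedFDeriv_graph_le {u : ℝ → ℝ} {n : ℕ} (hu : ContDiff ℝ n u) {D : ℝ} (hD : 1 ≤ D) {k : ℕ} (hk : k ≤ n)
    (hbd : ∀ i, 1 ≤ i → i ≤ k → ∀ θ, |iteratedDeriv i u θ| ≤ D ^ i) :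
    ∀ i, 1 ≤ i → i ≤ k → ∀ θ, ‖iteratedFDeriv ℝ i (fun θ : ℝ => (θ, u θ)) θ‖ ≤ D ^ i := by
  intro i hi1 hik θ
  have hin : (i : WithTop ℕ∞) ≤ n := by exact_mod_cast hik.trans hk
  have hid : ContDiff ℝ (n : WithTop ℕ∞) (fun x : ℝ => x) := contDiff_id
  rw [iteratedFDeriv_prodMk (f := fun x : ℝ => x) hid.contDiffAt hu.contDiffAt hin,
    ContinuousMultilinearMap.opNorm_prod]
  refine max_le ((norm_iteratedFDeriv_id_le i hi1 θ).trans (one_le_pow₀ hD)) ?_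
  rw [norm_iteratedFDeriv_eq_norm_iteratedDeriv, Real.norm_eq_abs]
  exact hbd i hi1 hik θ

/-- **Chain rule along the graph**: `F ∘ g` with `‖Dⁱ F(g θ)‖ ≤ B` (`i ≤ k`) and `‖Dⁱ g(θ)‖ ≤ Dⁱ` (`1 ≤ i ≤ k`) has
`‖Dᵏ(F ∘ g)(θ)‖ ≤ k!·B·Dᵏ`. -/
theorem norm_iteratedFDeriv_comp_graph_le {u : ℝ → ℝ} {F : ℝ × ℝ → ℝ} {n : ℕ} (hu : ContDiff ℝ n u) (hF : ContDiff ℝ n F)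
    {k : ℕ} (hk : k ≤ n) {B D : ℝ} (θ : ℝ) (hB : ∀ i ≤ k, ‖iteratedFDeriv ℝ i F (θ, u θ)‖ ≤ B)
    (hg : ∀ i, 1 ≤ i → i ≤ k → ‖iteratedFDeriv ℝ i (fun θ : ℝ => (θ, u θ)) θ‖ ≤ D ^ i) :
    ‖iteratedFDeriv ℝ k (fun θ : ℝ => F (θ, u θ)) θ‖ ≤ k.factorial * B * D ^ k := by
  have hg' : ContDiff ℝ (n : WithTop ℕ∞) (fun θ : ℝ => (θ, u θ)) := contDiff_id.prodMk hu
  exact norm_iteratedFDeriv_comp_le (g := F) (f := fun θ : ℝ => (θ, u θ)) (N := (n : WithTop ℕ∞)) hF hg'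
    (by exact_mod_cast hk) θ hB hg

/-- The iterated derivatives of `x ↦ x⁻¹` at a point `x ≥ d` (`0 < d ≤ 1`), orders `≤ 3`: `|·| ≤ 6/d⁴`. -/
theorem abs_iteratedDeriv_inv_le {d x : ℝ} (hd : 0 < d) (hd1 : d ≤ 1) (hx : d ≤ x) (i : ℕ) (hi : i ≤ 3) :
    |iteratedDeriv i (fun y : ℝ => y⁻¹) x| ≤ 6 / d ^ 4 := by
  have hx0 : 0 < x := hd.trans_le hx
  have hinv : (fun y : ℝ => y⁻¹) = Inv.inv := rfl
  rw [iteratedDeriv_eq_iterate, hinv, iter_deriv_inv]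
  have hd4 : 0 < d ^ 4 := by positivity
  have hz : x ^ (-1 - (i : ℤ)) = (x ^ (i + 1))⁻¹ := by
    rw [show (-1 - (i : ℤ)) = -((i + 1 : ℕ) : ℤ) by push_cast; ring, zpow_neg, zpow_natCast]
  rw [hz, abs_mul, abs_mul, abs_inv, abs_of_pos (pow_pos hx0 _), abs_pow, abs_neg, abs_one, one_pow, one_mul,
    Nat.abs_cast]
  -- `i! ≤ 6` and `1/x^(i+1) ≤ 1/d^4`
  have hfac : (i.factorial : ℝ) ≤ 6 := by
    have h := Nat.factorial_le hi
    exact_mod_cast h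
  have h1 : d ^ 4 ≤ d ^ (i + 1) := pow_le_pow_of_le_one hd.le hd1 (by omega)
  have h2 : d ^ (i + 1) ≤ x ^ (i + 1) := pow_le_pow_left₀ hd.le hx _
  have hxpow : (x ^ (i + 1))⁻¹ ≤ (d ^ 4)⁻¹ := inv_anti₀ hd4 (h1.trans h2)
  rw [div_eq_mul_inv]
  exact mul_le_mul hfac hxpow (inv_nonneg.2 (pow_nonneg hx0.le _)) (by norm_num)

/-- **Reciprocal of a function bounded below**: `w ≥ d` on `ℝ` (`0 < d ≤ 1`), `w ∈ Cⁿ`, `‖Dⁱ w(θ)‖ ≤ Eⁱ` (`1 ≤ i ≤ m`, `m ≤ 3`, `m ≤ n`)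
⇒ `‖Dᵐ (w⁻¹)(θ)‖ ≤ m!·(6/d⁴)·Eᵐ`. -/
theorem norm_iteratedFDeriv_inv_comp_le {w : ℝ → ℝ} {n : ℕ} (hw : ContDiff ℝ n w) {d : ℝ} (hd : 0 < d) (hd1 : d ≤ 1)
    (hwd : ∀ θ, d ≤ w θ) {m : ℕ} (hm3 : m ≤ 3) (hmn : m ≤ n) {E : ℝ} (θ : ℝ)
    (hE : ∀ i, 1 ≤ i → i ≤ m → ‖iteratedFDeriv ℝ i w θ‖ ≤ E ^ i) :
    ‖iteratedFDeriv ℝ m (fun θ => (w θ)⁻¹) θ‖ ≤ m.factorial * (6 / d ^ 4) * E ^ m := by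
  have ht : Set.range w ⊆ Set.Ioi (d / 2) := by
    rintro _ ⟨θ', rfl⟩
    exact lt_of_lt_of_le (by linarith) (hwd θ')
  have hinv : ContDiffOn ℝ (n : WithTop ℕ∞) (Inv.inv : ℝ → ℝ) (Set.Ioi (d / 2)) :=
    (contDiffOn_inv ℝ).mono fun x hx => by
      simp only [Set.mem_compl_iff, Set.mem_singleton_iff]
      exact ne_of_gt (lt_trans (by positivity) hx)
  have h := norm_iteratedFDeriv_comp_le' (g := (Inv.inv : ℝ → ℝ)) (f := w) (N := (n : WithTop ℕ∞)) ht
    (uniqueDiffOn_Ioi _) hinv hw (by exact_mod_cast hmn) θ (C := 6 / d ^ 4) (D := E) ?_ hE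
  · exact h
  · intro i hi
    rw [(iteratedFDerivWithin_of_isOpen i isOpen_Ioi) (ht ⟨θ, rfl⟩), norm_iteratedFDeriv_eq_norm_iteratedDeriv,
      Real.norm_eq_abs]
    exact abs_iteratedDeriv_inv_le hd hd1 (hwd θ) i (hi.trans hm3)

/-! ## §2 Arithmetic of the bootstrap constants -/

/-- `j!·B·D^j ≤ (6BD)^j` for `1 ≤ j ≤ 3`, `B, D ≥ 1`. -/
theorem factorial_mul_le_pow {B D : ℝ} (hB : 1 ≤ B) (hD : 1 ≤ D) (j : ℕ) (hj1 : 1 ≤ j) (hj3 : j ≤ 3) :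
    (j.factorial : ℝ) * B * D ^ j ≤ (6 * B * D) ^ j := by
  have hD0 : 0 ≤ D := by linarith
  have hB0 : 0 ≤ B := by linarith
  have hBB : B ≤ B ^ 2 := by nlinarith
  have hBBB : B ≤ B ^ 3 := by nlinarith
  interval_cases j
  · norm_num [Nat.factorial]; nlinarith
  · norm_num [Nat.factorial]
    have h36 : (6 * B * D) ^ 2 = 36 * B ^ 2 * D ^ 2 := by ring
    rw [h36]; nlinarith [mul_nonneg (sub_nonneg.2 hBB) (pow_nonneg hD0 2), pow_nonneg hD0 2]
  · norm_num [Nat.factorial]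
    have h216 : (6 * B * D) ^ 3 = 216 * B ^ 3 * D ^ 3 := by ring
    rw [h216]; nlinarith [mul_nonneg (sub_nonneg.2 hBBB) (pow_nonneg hD0 3), pow_nonneg hD0 3]

/-- **The Leibniz sum of the bootstrap**: with `D ≤ E`, `0 ≤ D`, `0 ≤ B`, `0 ≤ C`,
`Σ_{i ≤ k} C(k,i)·(i!·B·Dⁱ)·((k−i)!·C·E^{k−i}) ≤ (k+1)!·B·C·Eᵏ`. -/
theorem leibniz_sum_le {B C D E : ℝ} (hB : 0 ≤ B) (hC : 0 ≤ C) (hD : 0 ≤ D) (hDE : D ≤ E) (k : ℕ) :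
    ∑ i ∈ range (k + 1), (k.choose i : ℝ) * ((i.factorial : ℝ) * B * D ^ i) * (((k - i).factorial : ℝ) * C * E ^ (k - i)) ≤
      ((k + 1).factorial : ℝ) * B * C * E ^ k := by
  have hE : 0 ≤ E := hD.trans hDE
  have hterm : ∀ i ∈ range (k + 1),
      (k.choose i : ℝ) * ((i.factorial : ℝ) * B * D ^ i) * (((k - i).factorial : ℝ) * C * E ^ (k - i)) ≤
        (k.factorial : ℝ) * B * C * E ^ k := by
    intro i hi
    have hik : i ≤ k := Nat.lt_succ_iff.1 (mem_range.1 hi)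
    have hchoose : (k.choose i : ℝ) * (i.factorial : ℝ) * ((k - i).factorial : ℝ) = (k.factorial : ℝ) := by
      exact_mod_cast Nat.choose_mul_factorial_mul_factorial hik
    have hpow : D ^ i * E ^ (k - i) ≤ E ^ k := by
      calc D ^ i * E ^ (k - i) ≤ E ^ i * E ^ (k - i) :=
            mul_le_mul_of_nonneg_right (pow_le_pow_left₀ hD hDE i) (pow_nonneg hE _)
        _ = E ^ k := by rw [← pow_add, Nat.add_sub_cancel' hik]
    calc (k.choose i : ℝ) * ((i.factorial : ℝ) * B * D ^ i) * (((k - i).factorial : ℝ) * C * E ^ (k - i))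
        = ((k.choose i : ℝ) * (i.factorial : ℝ) * ((k - i).factorial : ℝ)) * B * C * (D ^ i * E ^ (k - i)) := by ring
      _ = (k.factorial : ℝ) * B * C * (D ^ i * E ^ (k - i)) := by rw [hchoose]
      _ ≤ (k.factorial : ℝ) * B * C * E ^ k := by
          apply mul_le_mul_of_nonneg_left hpow; positivity
  calc ∑ i ∈ range (k + 1), (k.choose i : ℝ) * ((i.factorial : ℝ) * B * D ^ i) * (((k - i).factorial : ℝ) * C * E ^ (k - i))
      ≤ ∑ _i ∈ range (k + 1), (k.factorial : ℝ) * B * C * E ^ k := sum_le_sum hterm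
    _ = ((k + 1).factorial : ℝ) * B * C * E ^ k := by
        rw [sum_const, card_range, nsmul_eq_mul, Nat.factorial_succ]; push_cast; ring

/-- **The closing inequality**: `(k+1)!·6^{k+1}·B^{k+1} ≤ 31104·B⁴` for `k ≤ 3`, `B ≥ 1`. -/
theorem bootstrap_closing {B : ℝ} (hB : 1 ≤ B) (k : ℕ) (hk : k ≤ 3) :
    ((k + 1).factorial : ℝ) * 6 ^ (k + 1) * B ^ (k + 1) ≤ 31104 * B ^ 4 := by
  have hB0 : 0 ≤ B := by linarith
  have hB2 := one_le_pow₀ (n := 2) hB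
  have hB3 := one_le_pow₀ (n := 3) hB
  interval_cases k
  · norm_num [Nat.factorial]; nlinarith [pow_nonneg hB0 4]
  · norm_num [Nat.factorial]; nlinarith [pow_nonneg hB0 4]
  · norm_num [Nat.factorial]; nlinarith [pow_nonneg hB0 4]
  · norm_num [Nat.factorial]

/-! ## §3 The bootstrap -/

section Bootstrap

variable {u : ℝ → ℝ} {Gθ Gt : ℝ × ℝ → ℝ} {B d : ℝ}
  (hu : ContDiff ℝ 4 u) (hGθ : ContDiff ℝ 3 Gθ) (hGt : ContDiff ℝ 3 Gt) (hB : 1 ≤ B)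
  (hbθ : ∀ θ, ∀ i ≤ 3, ‖iteratedFDeriv ℝ i Gθ (θ, u θ)‖ ≤ B)
  (hbt : ∀ θ, ∀ i ≤ 3, ‖iteratedFDeriv ℝ i Gt (θ, u θ)‖ ≤ B)
  (hd : 0 < d) (hd1 : d ≤ 1) (hdt : ∀ θ, d ≤ Gt (θ, u θ))
  (hderiv : ∀ θ, deriv u θ = -Gθ (θ, u θ) / Gt (θ, u θ))

include hB hd hd1 in
/-- The bootstrap constant `D = 31104·B⁴/d⁴` is `≥ 1`. -/
theorem one_le_bootD : (1 : ℝ) ≤ 31104 * B ^ 4 / d ^ 4 := by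
  have hd4 : 0 < d ^ 4 := by positivity
  have hd4' : d ^ 4 ≤ 1 := pow_le_one₀ hd.le hd1
  rw [le_div_iff₀ hd4]
  nlinarith [one_le_pow₀ (n := 4) hB]

include hu hGθ hGt hB hbθ hbt hd hd1 hdt hderiv in
/-- **ONE STEP OF THE BOOTSTRAP**: if `|u^{(i)}| ≤ Dⁱ` for `1 ≤ i ≤ k` (`k ≤ 3`, `D = (31104 * B ^ 4 / d ^ 4)`), then
`|u^{(k+1)}(θ)| ≤ (k+1)!·B·(6/d⁴)·(6BD)ᵏ`. -/
theorem abs_iteratedDeriv_succ_le_of_lower (k : ℕ) (hk : k ≤ 3)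
    (hlow : ∀ i, 1 ≤ i → i ≤ k → ∀ θ, |iteratedDeriv i u θ| ≤ (31104 * B ^ 4 / d ^ 4) ^ i) (θ : ℝ) :
    |iteratedDeriv (k + 1) u θ| ≤ ((k + 1).factorial : ℝ) * B * (6 / d ^ 4) * (6 * B * (31104 * B ^ 4 / d ^ 4)) ^ k := by
  set D := (31104 * B ^ 4 / d ^ 4) with hDdef
  have hD1 : 1 ≤ D := one_le_bootD hB hd hd1
  have hB0 : 0 ≤ B := by linarith
  have hu3 : ContDiff ℝ (3 : ℕ) u := hu.of_le (by norm_num)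
  -- `u′ = f·g` with `f = −G_θ∘graph`, `g = (G_t∘graph)⁻¹`
  set f : ℝ → ℝ := fun θ => -Gθ (θ, u θ) with hfdef
  set w : ℝ → ℝ := fun θ => Gt (θ, u θ) with hwdef
  set g : ℝ → ℝ := fun θ => (w θ)⁻¹ with hgdef
  have hgraph : ContDiff ℝ ((3 : ℕ) : WithTop ℕ∞) (fun θ : ℝ => (θ, u θ)) := contDiff_id.prodMk hu3
  have hfC : ContDiff ℝ ((3 : ℕ) : WithTop ℕ∞) f := (hGθ.comp hgraph).neg
  have hwC : ContDiff ℝ ((3 : ℕ) : WithTop ℕ∞) w := hGt.comp hgraph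
  have hwd : ∀ θ, d ≤ w θ := fun θ => hdt θ
  have hgC : ContDiff ℝ ((3 : ℕ) : WithTop ℕ∞) g := hwC.inv fun θ => ne_of_gt (hd.trans_le (hwd θ))
  have hderiv' : deriv u = fun θ => f θ * g θ := by
    funext θ; rw [hderiv θ]; simp only [hfdef, hgdef, hwdef, div_eq_mul_inv, neg_mul]
  -- graph bounds up to order `k`
  have hgr : ∀ i, 1 ≤ i → i ≤ k → ∀ θ, ‖iteratedFDeriv ℝ i (fun θ : ℝ => (θ, u θ)) θ‖ ≤ D ^ i :=
    norm_iteratedFDeriv_graph_le hu3 hD1 hk hlow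
  -- bounds on `f`
  have hf_bd : ∀ i ≤ k, ‖iteratedFDeriv ℝ i f θ‖ ≤ (i.factorial : ℝ) * B * D ^ i := by
    intro i hi
    have hneg : f = -(fun θ : ℝ => Gθ (θ, u θ)) := rfl
    rw [hneg, iteratedFDeriv_neg_apply, norm_neg]
    exact norm_iteratedFDeriv_comp_graph_le hu3 hGθ (hi.trans hk) θ (fun j hj => hbθ θ j (hj.trans (hi.trans hk)))
      fun j hj1 hj2 => hgr j hj1 (hj2.trans hi) θ
  -- bounds on `w`, then on `g = w⁻¹`
  have hw_bd : ∀ j, 1 ≤ j → j ≤ k → ‖iteratedFDeriv ℝ j w θ‖ ≤ (6 * B * D) ^ j := by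
    intro j hj1 hj2
    have h := norm_iteratedFDeriv_comp_graph_le hu3 hGt (hj2.trans hk) θ (fun i hi => hbt θ i (hi.trans (hj2.trans hk)))
      fun i hi1 hi2 => hgr i hi1 (hi2.trans hj2) θ
    exact h.trans (factorial_mul_le_pow hB hD1 j hj1 (hj2.trans hk))
  have hg_bd : ∀ m ≤ k, ‖iteratedFDeriv ℝ m g θ‖ ≤ (m.factorial : ℝ) * (6 / d ^ 4) * (6 * B * D) ^ m := by
    intro m hm
    exact norm_iteratedFDeriv_inv_comp_le hwC hd hd1 hwd (hm.trans hk) (hm.trans hk) θ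
      fun i hi1 hi2 => hw_bd i hi1 (hi2.trans hm)
  -- Leibniz
  rw [iteratedDeriv_succ', hderiv', ← Real.norm_eq_abs, ← norm_iteratedFDeriv_eq_norm_iteratedDeriv]
  have hL := norm_iteratedFDeriv_mul_le (N := ((3 : ℕ) : WithTop ℕ∞)) hfC hgC θ (n := k) (by exact_mod_cast hk)
  refine hL.trans ?_
  have hsum : ∑ i ∈ range (k + 1), (k.choose i : ℝ) * ‖iteratedFDeriv ℝ i f θ‖ * ‖iteratedFDeriv ℝ (k - i) g θ‖ ≤
      ∑ i ∈ range (k + 1), (k.choose i : ℝ) * ((i.factorial : ℝ) * B * D ^ i) *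
        (((k - i).factorial : ℝ) * (6 / d ^ 4) * (6 * B * D) ^ (k - i)) := by
    refine sum_le_sum fun i hi => ?_
    have hik : i ≤ k := Nat.lt_succ_iff.1 (mem_range.1 hi)
    have h1 := hf_bd i hik
    have h2 := hg_bd (k - i) (Nat.sub_le k i)
    have h0 : 0 ≤ (k.choose i : ℝ) := by positivity
    calc (k.choose i : ℝ) * ‖iteratedFDeriv ℝ i f θ‖ * ‖iteratedFDeriv ℝ (k - i) g θ‖
        ≤ (k.choose i : ℝ) * ((i.factorial : ℝ) * B * D ^ i) * ‖iteratedFDeriv ℝ (k - i) g θ‖ := by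
          gcongr
      _ ≤ (k.choose i : ℝ) * ((i.factorial : ℝ) * B * D ^ i) * (((k - i).factorial : ℝ) * (6 / d ^ 4) * (6 * B * D) ^ (k - i)) := by
          apply mul_le_mul_of_nonneg_left h2
          have : 0 ≤ D ^ i := pow_nonneg (by linarith) i
          positivity
  refine hsum.trans ?_
  have hDE : D ≤ 6 * B * D := by nlinarith
  exact leibniz_sum_le hB0 (by positivity) (by linarith) hDE k

include hu hGθ hGt hB hbθ hbt hd hd1 hdt hderiv in
/-- **The step closes**: under the same hypothesis, `|u^{(k+1)}(θ)| ≤ D^{k+1}`. -/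
theorem abs_iteratedDeriv_succ_le_pow (k : ℕ) (hk : k ≤ 3)
    (hlow : ∀ i, 1 ≤ i → i ≤ k → ∀ θ, |iteratedDeriv i u θ| ≤ (31104 * B ^ 4 / d ^ 4) ^ i) (θ : ℝ) :
    |iteratedDeriv (k + 1) u θ| ≤ (31104 * B ^ 4 / d ^ 4) ^ (k + 1) := by
  refine (abs_iteratedDeriv_succ_le_of_lower hu hGθ hGt hB hbθ hbt hd hd1 hdt hderiv k hk hlow θ).trans ?_
  have hD1 : 1 ≤ (31104 * B ^ 4 / d ^ 4) := one_le_bootD hB hd hd1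
  have hD0 : 0 ≤ (31104 * B ^ 4 / d ^ 4) := by linarith
  have hd4 : 0 < d ^ 4 := by positivity
  have hclose := bootstrap_closing hB k hk
  -- `(k+1)!·B·(6/d⁴)·(6BD)^k = ((k+1)!·6^{k+1}·B^{k+1}/d⁴)·D^k ≤ (31104 B⁴/d⁴)·D^k = D^{k+1}`
  have hid : ((k + 1).factorial : ℝ) * B * (6 / d ^ 4) * (6 * B * (31104 * B ^ 4 / d ^ 4)) ^ k =
      (((k + 1).factorial : ℝ) * 6 ^ (k + 1) * B ^ (k + 1)) / d ^ 4 * (31104 * B ^ 4 / d ^ 4) ^ k := by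
    rw [mul_pow, mul_pow]; field_simp; ring
  rw [hid, show (31104 * B ^ 4 / d ^ 4) ^ (k + 1) = (31104 * B ^ 4 / d ^ 4) * (31104 * B ^ 4 / d ^ 4) ^ k from
    pow_succ' _ _]
  exact mul_le_mul_of_nonneg_right (div_le_div_of_nonneg_right hclose hd4.le) (pow_nonneg hD0 k)

include hu hGθ hGt hB hbθ hbt hd hd1 hdt hderiv in
/-- **DERIVATIVE BOUNDS TO ORDER FOUR FOR THE IMPLICIT FUNCTION**: `|u^{(j)}(θ)| ≤ (31104·B⁴/d⁴)^j` for `1 ≤ j ≤ 4`. -/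
theorem abs_iteratedDeriv_le_pow_of_implicit (j : ℕ) (hj1 : 1 ≤ j) (hj4 : j ≤ 4) (θ : ℝ) :
    |iteratedDeriv j u θ| ≤ (31104 * B ^ 4 / d ^ 4) ^ j := by
  have step := fun k hk hlow => abs_iteratedDeriv_succ_le_pow hu hGθ hGt hB hbθ hbt hd hd1 hdt hderiv k hk hlow
  have P1 : ∀ θ, |iteratedDeriv 1 u θ| ≤ (31104 * B ^ 4 / d ^ 4) ^ 1 := step 0 (by norm_num) (fun i hi1 hi0 => by omega)
  have L1 : ∀ i, 1 ≤ i → i ≤ 1 → ∀ θ, |iteratedDeriv i u θ| ≤ (31104 * B ^ 4 / d ^ 4) ^ i := by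
    intro i hi1 hi2 θ; obtain rfl : i = 1 := le_antisymm hi2 hi1; exact P1 θ
  have P2 : ∀ θ, |iteratedDeriv 2 u θ| ≤ (31104 * B ^ 4 / d ^ 4) ^ 2 := step 1 (by norm_num) L1
  have L2 : ∀ i, 1 ≤ i → i ≤ 2 → ∀ θ, |iteratedDeriv i u θ| ≤ (31104 * B ^ 4 / d ^ 4) ^ i := by
    intro i hi1 hi2 θ
    rcases Nat.lt_or_ge i 2 with h | h
    · exact L1 i hi1 (by omega) θ
    · obtain rfl : i = 2 := le_antisymm hi2 h; exact P2 θ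
  have P3 : ∀ θ, |iteratedDeriv 3 u θ| ≤ (31104 * B ^ 4 / d ^ 4) ^ 3 := step 2 (by norm_num) L2
  have L3 : ∀ i, 1 ≤ i → i ≤ 3 → ∀ θ, |iteratedDeriv i u θ| ≤ (31104 * B ^ 4 / d ^ 4) ^ i := by
    intro i hi1 hi2 θ
    rcases Nat.lt_or_ge i 3 with h | h
    · exact L2 i hi1 (by omega) θ
    · obtain rfl : i = 3 := le_antisymm hi2 h; exact P3 θ
  have P4 : ∀ θ, |iteratedDeriv 4 u θ| ≤ (31104 * B ^ 4 / d ^ 4) ^ 4 := step 3 (by norm_num) L3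
  rcases Nat.lt_or_ge j 4 with h | h
  · exact L3 j hj1 (by omega) θ
  · obtain rfl : j = 4 := le_antisymm hj4 h; exact P4 θ

end Bootstrap

end Summit.HubbardSuperconductivity.HubbardSuperconductivity.Theorems.PerturbedFermiCurve

end
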